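import Summits.AtomisticToContinuum.HydrodynamicLimit.Theses.StiffCollisionalRelaxation
import Summits.AtomisticToContinuum.HydrodynamicLimit.Theses.CollisionIsometryCLT
import Summits.AtomisticToContinuum.HydrodynamicLimit.Theorems.StiffCollisionalRelaxationAprioriBoundsFibreDefs
import Summits.AtomisticToContinuum.HydrodynamicLimit.Theorems.StiffCollisionalRelaxationAprioriBoundsFibreDefsR4

/-!
# Line `tail-occupation-variance` for the crux `AprioriBounds` (stmt-AtomisticToContinuum-14827) — skeleton r1
(crux-strategist planner-cstrat-stmt-AtomisticToContinuum-14827-s1-0, 2026-08-17; an ALTERNATIVE to the live line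
`fibre-deficit-transfer`, whose skeleton/registration it does not touch)

Crux decl: `Summit.AtomisticToContinuum.HydrodynamicLimit.Theses.StiffCollisionalRelaxation.AprioriBounds` (rank 4)
= `…Theses.CollisionIsometryCLT.AprioriBoundsPreShock` (rank 5), one `Prop` (`AprioriBoundsNegative.aprioriBounds_iff`:
prefix → `PartOneAt ∧ PartTwoAt`).  This skeleton concludes BOTH by name (`AprioriBounds_of`, `AprioriBoundsPreShock_of`).

## The line in one sentence

Component (i) — `∃ λ > 0 ∃ C, P_N{C < ∫₀ᵗ (N+1)⁻¹∑ᵢ e^{λ|vᵢ(s)|²} ds} → 0` with `C` FIXED in `N` — is SIZE × CONCENTRATION: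
the SIZE of the time-integrated one-particle tail occupations `occ_K = ∫₀ᵗ frac_K(Φ_s ·) ds` is bounded IN THE MEAN by
the pre-shock Gaussian-tail item (`FarTailAllAt`: `E occ_K ≤ tAe^{−K/2Θ}` for ALL levels `K`, stub 2, ⇐ stmt-14415 by the
landed glue `farTailAll_of_gaussianTails`), and their CONCENTRATION is the new stub 3: `Var_{P_N}(occ_K) → 0` for each
FIXED level `K`.  Chebyshev at each level (stub 4) turns the pair into an in-probability Gaussian profile of the
time-integrated occupations, and the λ-dial / layer cake / Markov-on-the-geometric-top argument (stub 5, the template is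
the landed `Theorems.FibreDeficitTransfer.stub_partOnePrime`) gives `PartOneAt` with `λ < 1/(2 max Θ)` and
`Cexp := ∑_K e^{λ(K+1)} tAe^{−K/2Θ} + 1`.  Component (ii) is imported verbatim (stub 1 ⇐ stmt-9201, landed glue
`AdiabatCeiling.partTwo_of_kineticRangeControl`), exactly as in every line on this crux.

## Why this dodges the STUCK goal of the live line

The live line's open dynamical stub `stub_linStatL1` is HYDRODYNAMICS IN THE MEAN on `[0,t]` (`LinStatL1VanishAt` ⇐
`HydroLimitProfilewiseBand`, stmt-17372) — conjunct-strength and circular for the two routes that consume 14827 as an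
INPUT to the conjunct (lead a1, cycle-1 finding 1).  It is needed there because the transfer delivers a Gaussian profile
of `frac_K(s)` IN PROBABILITY at every level, which requires identifying the local equilibrium.  Here no limit is ever
identified: the mean is only BOUNDED (an inequality, stub 2) and the fluctuation is only required to VANISH (stub 3).
`Var(occ_K) → 0` is (given stub 2) exactly what separates the typed in-probability form of (i) from its tightness form
(landed `partOneTight_of_tails`; the landed witness `AprioriBoundsNegative.expMoment_bounds_not_sufficient` is an
`N`-independent macroscopic MIXTURE — the one scenario with `Var(occ_K) ↛ 0`).  It is the weakest common consequence of
every dynamical closure on the table: time-integrated relative entropy `o(N)` (the live line's `KLIntegratedVanishAt`,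
by its own Hoeffding transfer), a one-body Maxwellian LLN (`AnosovRotorDice.MaxwellianOneBody`, stmt-14290), pair
decorrelation of tagged spheres, or Efron–Stein: `OneSphereInfluence.HardCorePoincare` (stmt-13619, statics) + a
one-sphere resampling influence `∑ᵢ E condVar₋ᵢ(occ_K) → 0` (the stmt-13618 statement for the observable `occ_K`);
and it is implied by neither the conjunct nor (i), and implies neither.

## Disproof used (`Cruxes/AprioriBounds/Disproof.lean`, cycle 4, rc 0; no `-- Targets` for this line)
§4d/§9e/§9g `∀λ` false, `λ < 1/(2θ₀)` on the rung — `λ` is produced by the dial of stub 5 below `1/(2 max(Θ,Θ'))`;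
§2–§3 concern (ii), kept verbatim (stub 1); §7–§8 need `t ≥ T` — stubs 2, 3 carry the pre-shock prefix `t < T`;
`localGibbsLaw` is a probability measure for `σ ≤ 1/2` (hypothesis of stubs 4, 5).  Equilibrium unit test of stub 3:
under the flow-invariant homogeneous law (`HomogeneousInvariance`, landed) the velocities at each fixed time are i.i.d.
Maxwellians given the positions, so `Var frac_K(s) = p_K(1−p_K)/(N+1)` and `Var occ_K ≤ t² /(4(N+1)) → 0` for EVERY flow
family (Cauchy–Schwarz in `s`) — true and cheap, like the equilibrium instances of the live line's stubs.
-/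

noncomputable section

open MeasureTheory ProbabilityTheory Filter Set Topology
open scoped ENNReal

namespace Summit.AtomisticToContinuum.HydrodynamicLimit.Cruxes.AprioriBounds.TailOccupationVariance

open Literature.MathematicalPhysics.KineticTheory Literature.Analysis.FluidPDE
open Summit.AtomisticToContinuum.HydrodynamicLimit.Theorems.AprioriBoundsNegative (PartOneAt PartTwoAt)
open Summit.AtomisticToContinuum.HydrodynamicLimit.Theorems.VisitLedgerUpscattering (Cfg Flow Flows NiceProfiles)
open Summit.AtomisticToContinuum.HydrodynamicLimit.Theorems.FibreDeficitTransfer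

/-! ## Registered stubs (bodies `sorry`; every signature self-contained over LANDED vocabulary:
`frac` (`…AprioriBoundsFibreDefs`), `FarTailAllAt` (`…FibreDefsR4`), `PartOneAt`/`PartTwoAt` (`…Negative.EquilibriumRung`),
`NiceProfiles` (`…VisitLedgerDefs`), Mathlib's `ProbabilityTheory.variance`).  The time-integrated tail occupation of level `K`
is written inline as `(∫⁻ s in Icc 0 t, ENNReal.ofReal (frac K ((Φ N).flow s z))).toReal` (a number in `[0, t]`; the
lower integral is the one `FarTailAllAt` bounds in the mean). -/

namespace Holds

/-- STUB 1 `cellBounds` (OPEN — component (ii) VERBATIM under the crux prefix; an IMPORT docked to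
`GermanoSplitLES.KineticRangeControl` (stmt-9201) by the landed glue `AdiabatCeiling.partTwo_of_kineticRangeControl`).
Byte-identical to the live line's `stub_cellBounds` (one registered obligation serves both lines). -/
theorem stub_cellBounds :
    ∀ (a₀ θ₀ : T3 → ℝ) (u₀ : T3 → V3), Continuous a₀ → Continuous θ₀ → Continuous u₀ →
      (∀ x, 0 < a₀ x) → (∀ x, 0 < θ₀ x) →
      ∃ σ₀ : ℝ, 0 < σ₀ ∧ ∃ η₁ : ℝ, 0 < η₁ ∧ ∀ σ : ℝ, 0 < σ → σ < σ₀ →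
        ∀ (T : ℝ) (ρ θ : ℝ → T3 → ℝ) (u : ℝ → T3 → V3), IsHardSphereEulerSolution σ T ρ u θ →
        ∀ Φ : (N : ℕ) → HardSphereFlow (Torus.geometry (Fin 3)) (hsDiameter σ N) (N + 1),
          TendstoHydroFieldsAt (fun N => localGibbsLaw σ a₀ u₀ θ₀ N (Φ N)) Φ ρ u θ 0 →
          ∀ t : ℝ, 0 < t → t < T → (∀ s ∈ Icc 0 t, ∀ x, 2 * ρ s x * σ ^ 3 < η₁) →
            PartTwoAt σ a₀ θ₀ u₀ Φ t := by
  sorry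

/-- STUB 2 `farTailAll` (OPEN — the SIZE input: far tails at ALL levels in the MEAN, `FarTailAllAt`:
`E_N ∫₀ᵗ frac_K ds ≤ t·A·e^{−K/(2Θ)}` eventually in `N`, for all `K`).  Producer: the PRE-SHOCK tail item
`UGibbsSRBRigidity.GaussianTails` (stmt-14415) through the landed Markov–Tonelli glue `farTailAll_of_gaussianTails`
(p137042).  Byte-identical to the live line's `stub_farTailAll`. -/
theorem stub_farTailAll :
    ∀ (a₀ θ₀ : T3 → ℝ) (u₀ : T3 → V3), Continuous a₀ → Continuous θ₀ → Continuous u₀ →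
      (∀ x, 0 < a₀ x) → (∀ x, 0 < θ₀ x) →
      ∃ σ₀ : ℝ, 0 < σ₀ ∧ ∃ η₁ : ℝ, 0 < η₁ ∧ ∀ σ : ℝ, 0 < σ → σ < σ₀ →
        ∀ (T : ℝ) (ρ θ : ℝ → T3 → ℝ) (u : ℝ → T3 → V3), IsHardSphereEulerSolution σ T ρ u θ →
        ∀ Φ : (N : ℕ) → HardSphereFlow (Torus.geometry (Fin 3)) (hsDiameter σ N) (N + 1),
          TendstoHydroFieldsAt (fun N => localGibbsLaw σ a₀ u₀ θ₀ N (Φ N)) Φ ρ u θ 0 →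
          ∀ t : ℝ, 0 < t → t < T → (∀ s ∈ Icc 0 t, ∀ x, 2 * ρ s x * σ ^ 3 < η₁) →
            FarTailAllAt σ a₀ θ₀ u₀ Φ t := by
  sorry

/-- STUB 3 `occupationVariance` (OPEN — THE NEW LOAD-BEARING DYNAMICAL STUB, the CONCENTRATION input).  Under the crux
prefix, for EVERY FIXED level `K`, the variance under the local Gibbs law of the time-integrated one-particle tail occupation
`occ_K(z) = ∫₀ᵗ frac_K(Φ_s z) ds ∈ [0, t]` tends to `0` as `N → ∞`.  No rate, no uniformity in `K`, no identification of the
limit of the mean.  By exchangeability `Var occ_K = Var(ζ₁)/(N+1) + (N/(N+1))·Cov(ζ₁, ζ₂)` with `ζᵢ = ∫₀ᵗ 𝟙{K ≤ |vᵢ(s)|²} ds`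
the time-averaged tail sojourn of ONE tagged sphere, so the stub is equivalently PAIR DECORRELATION OF TIME-AVERAGED TAIL
SOJOURNS of two tagged spheres.  Sufficient: time-integrated relative entropy `o(N)` w.r.t. local Gibbs references (the live
line's `KLIntegratedVanishAt`, by its Hoeffding transfer), a one-body Maxwellian LLN (stmt-14290), or Efron–Stein
(`OneSphereInfluence.HardCorePoincare` stmt-13619 + `∑ᵢ E condVar₋ᵢ(occ_K) → 0`, the stmt-13618 statement for `occ_K`).
TRUE at equilibrium for every flow family (`Var occ_K ≤ t²/(4(N+1))`).  Why it might fail: it is a positive-time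
self-averaging statement for deterministic hard spheres at fixed `σ`, known only in the Boltzmann–Grad limit for short
times (Lanford; BGSS fluctuation theory); an `N`-independent macroscopic randomness of the far tails before `T` (the
shape of the landed witness `expMoment_bounds_not_sufficient`) would break it with (i) possibly intact. -/
theorem stub_occupationVariance :
    ∀ (a₀ θ₀ : T3 → ℝ) (u₀ : T3 → V3), Continuous a₀ → Continuous θ₀ → Continuous u₀ →
      (∀ x, 0 < a₀ x) → (∀ x, 0 < θ₀ x) →
      ∃ σ₀ : ℝ, 0 < σ₀ ∧ ∃ η₁ : ℝ, 0 < η₁ ∧ ∀ σ : ℝ, 0 < σ → σ < σ₀ →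
        ∀ (T : ℝ) (ρ θ : ℝ → T3 → ℝ) (u : ℝ → T3 → V3), IsHardSphereEulerSolution σ T ρ u θ →
        ∀ Φ : (N : ℕ) → HardSphereFlow (Torus.geometry (Fin 3)) (hsDiameter σ N) (N + 1),
          TendstoHydroFieldsAt (fun N => localGibbsLaw σ a₀ u₀ θ₀ N (Φ N)) Φ ρ u θ 0 →
          ∀ t : ℝ, 0 < t → t < T → (∀ s ∈ Icc 0 t, ∀ x, 2 * ρ s x * σ ^ 3 < η₁) →
            ∀ K : ℝ, Tendsto (fun N : ℕ => variance
              (fun z => (∫⁻ s in Icc 0 t, ENNReal.ofReal (frac K ((Φ N).flow s z))).toReal)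
              (localGibbsLaw σ a₀ u₀ θ₀ N (Φ N))) atTop (𝓝 0) := by
  sorry

/-- STUB 4 `occupationInProb_of_variance` (PROVABLE NOW, M — Chebyshev at each level).  For `0 < σ ≤ 1/2` (so that the local
Gibbs laws are probability measures, `isProbabilityMeasure_localGibbsLaw`), nice profiles, `t > 0`, any flow family:
vanishing variances of the occupations (stub 3's conclusion) and far tails in the mean (`FarTailAllAt`, stub 2's conclusion)
give the IN-PROBABILITY GAUSSIAN PROFILE OF THE TIME-INTEGRATED OCCUPATIONS at every level, with the SAME `Θ, A`:
`P_N{ tAe^{−K/(2Θ)} + η < occ_K } → 0` for all `K` and all `η > 0`.  Proof: `occ_K` is measurable (joint measurability of the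
flow on the torus, `HardSphereFlow.measurable_flow_prod_torus`, + `measurable_frac`) and bounded by `t` (`frac_mem_Icc`), hence
`MemLp 2`; `E occ_K = (E∫⁻…).toReal ≤ tAe^{−K/(2Θ)}` for `N ≥ N₀`; `{tAe^{−K/2Θ} + η < occ} ⊆ {η ≤ |occ − E occ|}` and
Chebyshev (`ProbabilityTheory.meas_ge_le_variance_div_sq`). -/
theorem stub_occupationInProb_of_variance :
    ∀ (σ : ℝ) (a₀ θ₀ : T3 → ℝ) (u₀ : T3 → V3)
      (Φ : (N : ℕ) → HardSphereFlow (Torus.geometry (Fin 3)) (hsDiameter σ N) (N + 1)) (t : ℝ),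
      0 < σ → σ ≤ 1 / 2 → NiceProfiles a₀ θ₀ u₀ → 0 < t →
      (∀ K : ℝ, Tendsto (fun N : ℕ => variance
          (fun z => (∫⁻ s in Icc 0 t, ENNReal.ofReal (frac K ((Φ N).flow s z))).toReal)
          (localGibbsLaw σ a₀ u₀ θ₀ N (Φ N))) atTop (𝓝 0)) →
      FarTailAllAt σ a₀ θ₀ u₀ Φ t →
        ∃ Θ A : ℝ, 0 < Θ ∧ ∀ K : ℝ, ∀ η : ℝ, 0 < η →
          Tendsto (fun N : ℕ => localGibbsLaw σ a₀ u₀ θ₀ N (Φ N)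
            {z | t * A * Real.exp (-(K / (2 * Θ))) + η <
              (∫⁻ s in Icc 0 t, ENNReal.ofReal (frac K ((Φ N).flow s z))).toReal}) atTop (𝓝 0) := by
  sorry

/-- STUB 5 `partOne_of_occupation` (PROVABLE NOW, M–L — the dial, with time-integrated occupations in place of the live line's
time-integrated per-time bad events).  For `0 < σ ≤ 1/2`, nice profiles, `t > 0`: the in-probability Gaussian profile of the
occupations (stub 4's conclusion, constants `Θ', A'`) and `FarTailAllAt` (constants `Θ, A`) give `PartOneAt`.  Plan:
`λ := 1/(4 max(Θ,Θ'))`; layer cake over integer levels, `(N+1)⁻¹∑ᵢ e^{λ|vᵢ|²} ≤ ∑_{K∈ℕ} e^{λ(K+1)} frac_K`, so by Tonelli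
`∫₀ᵗ(N+1)⁻¹∑ᵢe^{λ|vᵢ(s)|²}ds ≤ ∑_K e^{λ(K+1)} occ_K` on good orbits; `C_λ := ∑_K e^{λ(K+1)}·tA'e^{−K/(2Θ')}` (geometric),
`Cexp := C_λ + 1`.  Given `ε > 0` pick a level cut `M` with `2∑_{K>M} e^{λ(K+1)} tAe^{−K/(2Θ)} ≤ ε/2`; Markov on the top
(`FarTailAllAt`, `N ≥ N₀`): `P{∑_{K>M} e^{λ(K+1)}occ_K > 1/2} ≤ ε/2`; on the levels `K ≤ M` use stub 4 with
`η_K := e^{−λ(K+1)}/(2(M+1))`: off the union of the `M+1` bad events `∑_{K≤M} e^{λ(K+1)} occ_K ≤ C_λ + 1/2`.  Hence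
`P{Cexp < ∫₀ᵗ…} ≤ ∑_{K≤M} P(bad_K) + ε/2`, `limsup ≤ ε/2` for every `ε`.  Template: the landed
`Theorems.FibreDeficitTransfer.stub_partOnePrime` / `partOne_markov_step` (tools `pp_sum_range_exp_mul_exp_neg_le`,
`pp_lintegral_orbit_expAvg_le`, `measure_timeAvg_gt_le_of_trunc`). -/
theorem stub_partOne_of_occupation :
    ∀ (σ : ℝ) (a₀ θ₀ : T3 → ℝ) (u₀ : T3 → V3)
      (Φ : (N : ℕ) → HardSphereFlow (Torus.geometry (Fin 3)) (hsDiameter σ N) (N + 1)) (t : ℝ),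
      0 < σ → σ ≤ 1 / 2 → NiceProfiles a₀ θ₀ u₀ → 0 < t →
      (∃ Θ A : ℝ, 0 < Θ ∧ ∀ K : ℝ, ∀ η : ℝ, 0 < η →
          Tendsto (fun N : ℕ => localGibbsLaw σ a₀ u₀ θ₀ N (Φ N)
            {z | t * A * Real.exp (-(K / (2 * Θ))) + η <
              (∫⁻ s in Icc 0 t, ENNReal.ofReal (frac K ((Φ N).flow s z))).toReal}) atTop (𝓝 0)) →
      FarTailAllAt σ a₀ θ₀ u₀ Φ t → PartOneAt σ a₀ θ₀ u₀ Φ t := by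
  sorry

end Holds

/-! ## Stub statements by name -/

/-- Statement of registered stub 1 (`Holds.stub_cellBounds`). -/
def stub_cellBounds : Prop := type_of% Holds.stub_cellBounds
/-- Statement of registered stub 2 (`Holds.stub_farTailAll`). -/
def stub_farTailAll : Prop := type_of% Holds.stub_farTailAll
/-- Statement of registered stub 3 (`Holds.stub_occupationVariance`). -/
def stub_occupationVariance : Prop := type_of% Holds.stub_occupationVariance
/-- Statement of registered stub 4 (`Holds.stub_occupationInProb_of_variance`). -/
def stub_occupationInProb_of_variance : Prop := type_of% Holds.stub_occupationInProb_of_variance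
/-- Statement of registered stub 5 (`Holds.stub_partOne_of_occupation`). -/
def stub_partOne_of_occupation : Prop := type_of% Holds.stub_partOne_of_occupation

/-! ## Compositions (sorry-free) -/

/-- Component (i) under the crux prefix from stubs 3 (concentration), 2 (size), 4 (Chebyshev), 5 (dial):
`σ₀ := min (min σ₃ σ₂) (1/2)`, `η₁ := min η₃ η₂`. -/
theorem partOne_of (h3 : stub_occupationVariance) (h2 : stub_farTailAll)
    (h4 : stub_occupationInProb_of_variance) (h5 : stub_partOne_of_occupation) :
    ∀ (a₀ θ₀ : T3 → ℝ) (u₀ : T3 → V3), Continuous a₀ → Continuous θ₀ → Continuous u₀ →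
      (∀ x, 0 < a₀ x) → (∀ x, 0 < θ₀ x) →
      ∃ σ₀ : ℝ, 0 < σ₀ ∧ ∃ η₁ : ℝ, 0 < η₁ ∧ ∀ σ : ℝ, 0 < σ → σ < σ₀ →
        ∀ (T : ℝ) (ρ θ : ℝ → T3 → ℝ) (u : ℝ → T3 → V3), IsHardSphereEulerSolution σ T ρ u θ →
        ∀ Φ : (N : ℕ) → HardSphereFlow (Torus.geometry (Fin 3)) (hsDiameter σ N) (N + 1),
          TendstoHydroFieldsAt (fun N => localGibbsLaw σ a₀ u₀ θ₀ N (Φ N)) Φ ρ u θ 0 →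
          ∀ t : ℝ, 0 < t → t < T → (∀ s ∈ Icc 0 t, ∀ x, 2 * ρ s x * σ ^ 3 < η₁) →
            PartOneAt σ a₀ θ₀ u₀ Φ t := by
  intro a₀ θ₀ u₀ ha hθ hu ha0 hθ0
  have hP : NiceProfiles a₀ θ₀ u₀ := ⟨ha, hθ, hu, ha0, hθ0⟩
  obtain ⟨σ₃, hσ₃, η₃, hη₃, H3⟩ := (h3 : type_of% Holds.stub_occupationVariance) a₀ θ₀ u₀ ha hθ hu ha0 hθ0
  obtain ⟨σ₂, hσ₂, η₂, hη₂, H2⟩ := (h2 : type_of% Holds.stub_farTailAll) a₀ θ₀ u₀ ha hθ hu ha0 hθ0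
  have H4 : type_of% Holds.stub_occupationInProb_of_variance := h4
  have H5 : type_of% Holds.stub_partOne_of_occupation := h5
  refine ⟨min (min σ₃ σ₂) (1 / 2), lt_min (lt_min hσ₃ hσ₂) one_half_pos,
    min η₃ η₂, lt_min hη₃ hη₂, ?_⟩
  intro σ hσ hσlt T ρ θ u hsol Φ hLLN t ht htT hdil
  simp only [lt_min_iff] at hσlt hdil
  obtain ⟨⟨hs3, hs2⟩, hshalf⟩ := hσlt
  have hVar := H3 σ hσ hs3 T ρ θ u hsol Φ hLLN t ht htT (fun s hs x => (hdil s hs x).1)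
  have hFar : FarTailAllAt σ a₀ θ₀ u₀ Φ t :=
    H2 σ hσ hs2 T ρ θ u hsol Φ hLLN t ht htT (fun s hs x => (hdil s hs x).2)
  have hOcc := H4 σ a₀ θ₀ u₀ Φ t hσ hshalf.le hP ht hVar hFar
  exact H5 σ a₀ θ₀ u₀ Φ t hσ hshalf.le hP ht hOcc hFar

/-- **THE SKELETON THEOREM (r1).**  The five registered stubs (1 `cellBounds`, 2 `farTailAll`, 3 `occupationVariance` OPEN;
4, 5 provable now) imply the crux decl `StiffCollisionalRelaxation.AprioriBounds` BY NAME. -/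
theorem AprioriBounds_of (h1 : stub_cellBounds) (h2 : stub_farTailAll) (h3 : stub_occupationVariance)
    (h4 : stub_occupationInProb_of_variance) (h5 : stub_partOne_of_occupation) :
    Summit.AtomisticToContinuum.HydrodynamicLimit.Theses.StiffCollisionalRelaxation.AprioriBounds := by
  rw [Theorems.AprioriBoundsNegative.aprioriBounds_iff]
  intro a₀ θ₀ u₀ ha hθ hu ha0 hθ0
  obtain ⟨σ₁, hσ₁, η₁', hη₁', HI⟩ := partOne_of h3 h2 h4 h5 a₀ θ₀ u₀ ha hθ hu ha0 hθ0
  obtain ⟨σ₂, hσ₂, η₂', hη₂', HII⟩ := (h1 : type_of% Holds.stub_cellBounds) a₀ θ₀ u₀ ha hθ hu ha0 hθ0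
  refine ⟨min σ₁ σ₂, lt_min hσ₁ hσ₂, min η₁' η₂', lt_min hη₁' hη₂', ?_⟩
  intro σ hσ hσlt T ρ θ u hsol Φ hLLN t ht htT hdil
  simp only [lt_min_iff] at hσlt hdil
  exact ⟨HI σ hσ hσlt.1 T ρ θ u hsol Φ hLLN t ht htT (fun s hs x => (hdil s hs x).1),
    HII σ hσ hσlt.2 T ρ θ u hsol Φ hLLN t ht htT (fun s hs x => (hdil s hs x).2)⟩

/-- The same skeleton closes the `CollisionIsometryCLT` copy of the crux (one `Prop`). -/
theorem AprioriBoundsPreShock_of (h1 : stub_cellBounds) (h2 : stub_farTailAll) (h3 : stub_occupationVariance)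
    (h4 : stub_occupationInProb_of_variance) (h5 : stub_partOne_of_occupation) :
    Summit.AtomisticToContinuum.HydrodynamicLimit.Theses.CollisionIsometryCLT.AprioriBoundsPreShock :=
  AprioriBounds_of h1 h2 h3 h4 h5

/-- D-0027 §3.3 shape: the crux from the registered stubs. -/
example : Summit.AtomisticToContinuum.HydrodynamicLimit.Theses.StiffCollisionalRelaxation.AprioriBounds :=
  AprioriBounds_of Holds.stub_cellBounds Holds.stub_farTailAll Holds.stub_occupationVariance
    Holds.stub_occupationInProb_of_variance Holds.stub_partOne_of_occupation

end Summit.AtomisticToContinuum.HydrodynamicLimit.Cruxes.AprioriBounds.TailOccupationVariance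

end
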